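import Summits.BirchSwinnertonDyer.Rank1Residual.X11b.BDPRouteLocalNonsingularBridge
import Literature.NumberTheory.EllipticCurves.LocalPointsIntegersSubgroup
import HarnessLib

/-!
# X11b, route R1 — the `p`-Sylow subgroup of the component group `Φ_v = X(K_v)/X₀(K_v)` is reached
# by `K_v`-rational `p`-power torsion (`v ∤ p`; Silverman VII.6.3) — local input of atom (P11)

HONEST FRAMING (cell `b2b-bsdres`, run/shared/lean/b2b/bsd-rank1-residual/, verbatim in every
file): the goal of the cell is to DELETE the COMBINATION-SHAPED residual classes of the
Birch–Swinnerton-Dyer formula for ALL analytic-rank `≤ 1` elliptic curves over `ℚ` — "full BSD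
formula for every rank `≤ 1` curve in class `C`" assembled STRICTLY from published theorems — so
that the rank-`≤ 1` remainder becomes exactly the CONSTRUCTION-SHAPED classes, which are TYPED
(missing-input `Prop`s), NOT attempted. This is not "finishing BSD". Sub-cell
`b2b-bsdres-multr1-p1` (X11b, route R1 = Castella 2018 Thm. A re-proved along the author's
erratum); a RESEARCH ROUTE; no claim beyond the stated class; X11b stays CONSTRUCTION-SHAPED;
nothing here changes a label; no named fact is minted (theorems only; no definition; no `sorry`).

## What this file proves

* `natCard_quotient_span_singleton_eq_one_of_isUnit` — `#(𝒪_v/u) = 1` for a unit `u`.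
* **`exists_torsion_sub_mem_nonsingularReductionSubgroup`** — on the minimal model `X` of `E/K` at a
  finite place `v ∤ p`: every `x ∈ X(K_v)` whose class in `Φ_v = X(K_v)/X₀(K_v)` has `p`-power order
  is congruent modulo `X₀(K_v)` to a `p`-power TORSION point `t ∈ X(K_v)` (so `E(K_v)[p^∞] ↠ Φ_v[p^∞]`,
  the step "the `p`-part `c_v^{(p)}` of the Tamagawa number" of Greenberg's Lemma 3.3 / JSW17
  Prop. 3.3.4). Input: Silverman VII.6.3 / Milne I.3.3 in the tree's form
  `LocalPoints.exists_subgroup_baseChange` (a finite-index torsion-free `U ≤ X(K_v)` with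
  `[U : nU] = #(𝒪_v/n)`, `= 1` for `n = p^s`): `U' = c_v·U ⊆ X₀(K_v)` is `p`-divisible of finite
  index `n₀ = p^s m` (`p ∤ m`), and `m·x − u` (`p^s u = n₀ x`, `u ∈ U'`) is the required torsion
  point up to the unit `m` modulo the order of the class.
* `map_toAlgEquiv_map_ofId` — `K_v`-rational points are `Γ_{K_v}`-fixed in `X(K̄_v)`.

References: [SilvermanAEC2009] §VII.6 (Prop. 6.3, Ex. 7.6), VIII.§1; [MilneADT2006] I Lemma 3.3;
[GreenbergLNM1716] §4 proof of Thm. 4.1 (p. 74: "the `p`-part `c_v^{(p)}`").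
-/

noncomputable section

open scoped Classical NNReal

open NumberField IsDedekindDomain Field Function WeierstrassCurve
open Literature.NumberTheory.EllipticCurves Literature.NumberTheory.EllipticCurves.GreenbergSelmer
open Literature.NumberTheory.GaloisRepresentations

namespace Summit.BirchSwinnertonDyer.Rank1Residual.X11b.AcSelmer

variable {K : Type} [Field K] [NumberField K] {W : WeierstrassCurve K} {v : HeightOneSpectrum (𝓞 K)}

/-! ## 1. Local: `p`-power torsion of `X(K_v)` maps ONTO `Φ_v[p^∞]` -/

section Local

/-- `#(𝒪_v/u𝒪_v) = 1` for a unit `u`. [folklore] -/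
theorem natCard_quotient_span_singleton_eq_one_of_isUnit {u : v.adicCompletionIntegers K}
    (hu : IsUnit u) :
    Nat.card (v.adicCompletionIntegers K ⧸ Ideal.span {u}) = 1 := by
  rw [Ideal.span_singleton_eq_top.mpr hu]
  haveI : Subsingleton (v.adicCompletionIntegers K ⧸ (⊤ : Ideal (v.adicCompletionIntegers K))) :=
    Ideal.Quotient.subsingleton_iff.mpr rfl
  exact Nat.card_of_subsingleton (0 : v.adicCompletionIntegers K ⧸ (⊤ : Ideal _))

variable (W) in
/-- **The `p`-Sylow subgroup of `Φ_v = X(K_v)/X₀(K_v)` is reached by rational `p`-power torsion.**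
For an elliptic curve `E` over a number field `K`, a finite place `v` and a prime `p` with `v ∤ p`,
on the minimal model `X` at `v`: if the class of `x ∈ X(K_v)` modulo `X₀(K_v)` (points with
non-singular reduction) is killed by a power of `p`, then `x ≡ t (mod X₀(K_v))` for some `t ∈ X(K_v)`
of `p`-power order. From Silverman VII.6.3 in the tree's form (`LocalPoints.exists_subgroup_baseChange`:
a finite-index `U ≤ X(K_v)` with `[U : p^s U] = #(𝒪_v/p^s) = 1`): `U' = [X(K_v):X₀(K_v)]·U ⊆ X₀(K_v)` is
`p`-divisible of finite index `n₀ = p^s·m`, `p ∤ m`; with `p^s u = n₀ x`, `u ∈ U'`, the point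
`m x − u` is `p^s`-torsion and `≡ m x`, and `m` is invertible modulo the order of the class of `x`.
[cite: SilvermanAEC2009, Prop. VII.6.3 and §VII.6 Ex. 7.6] [cite: MilneADT2006, I Lemma 3.3] -/
theorem exists_torsion_sub_mem_nonsingularReductionSubgroup [W.IsElliptic] {p : ℕ} [Fact p.Prime]
    (hpv : (p : 𝓞 K) ∉ v.asIdeal)
    (x : ((W.localMinimalIntegralModel v).baseChange (v.adicCompletion K)).toAffine.Point)
    (hx : ∃ k : ℕ, p ^ k • x ∈ (W.localMinimalIntegralModel v).nonsingularReductionSubgroup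
      (integers_valuationRing_valuation (v.adicCompletionIntegers K) (v.adicCompletion K))) :
    ∃ t : ((W.localMinimalIntegralModel v).baseChange (v.adicCompletion K)).toAffine.Point,
      (∃ s : ℕ, p ^ s • t = 0) ∧ t - x ∈ (W.localMinimalIntegralModel v).nonsingularReductionSubgroup
        (integers_valuationRing_valuation (v.adicCompletionIntegers K) (v.adicCompletion K)) := by
  have hp : (p : ℕ).Prime := Fact.out
  set E₀K := (W.localMinimalIntegralModel v).nonsingularReductionSubgroup
    (integers_valuationRing_valuation (v.adicCompletionIntegers K) (v.adicCompletion K)) with hE₀K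
  haveI hXell : ((W.localMinimalIntegralModel v).baseChange (v.adicCompletion K)).IsElliptic :=
    W.isElliptic_map_localMinimalIntegralModel (v := v)
  -- `X₀(K_v)` has finite index `c_v`
  have hcv : (W.baseChange (v.adicCompletion K)).localTamagawaNumber (v.adicCompletionIntegers K) ≠ 0 :=
    W.localTamagawaNumber_baseChange_ne_zero v
  have hidx : E₀K.index ≠ 0 := by
    rw [hE₀K, ← localTamagawaNumber_eq_index_nonsingularReductionSubgroup]; exact hcv
  haveI hE₀fi : E₀K.FiniteIndex := ⟨hidx⟩
  -- Silverman VII.6.3: `U`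
  obtain ⟨U, hUfi, -, hUidx⟩ := LocalPoints.exists_subgroup_baseChange v (W.localMinimalIntegralModel v)
  haveI := hUfi
  have hpunit : IsUnit ((p : ℕ) : v.adicCompletionIntegers K) := by
    have h := HeightOneSpectrum.isUnit_algebraMap_adicCompletionIntegers K v hpv
    rwa [map_natCast] at h
  -- `U` is `p^s`-divisible for every `s`
  have hUdiv : ∀ (s : ℕ), ∀ u ∈ U, ∃ u₁ ∈ U, p ^ s • u₁ = u := by
    intro s u hu
    have h1 : (U.map (nsmulAddMonoidHom (p ^ s) : _ →+ _)).relIndex U = 1 := by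
      rw [hUidx (p ^ s) (pow_ne_zero s hp.ne_zero), Nat.cast_pow]
      exact natCard_quotient_span_singleton_eq_one_of_isUnit (hpunit.pow s)
    obtain ⟨u₁, hu₁, rfl⟩ := (AddSubgroup.relIndex_eq_one.mp h1) hu
    exact ⟨u₁, hu₁, rfl⟩
  -- `U' = c•U ⊆ X₀(K_v)`, `p`-divisible, of finite index
  set c := E₀K.index with hc
  set U' : AddSubgroup ((W.localMinimalIntegralModel v).baseChange (v.adicCompletion K)).toAffine.Point :=
    U.map (nsmulAddMonoidHom c : _ →+ _) with hU'
  have hU'E₀ : U' ≤ E₀K := by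
    rintro _ ⟨u, -, rfl⟩
    exact E₀K.nsmul_index_mem u
  have hU'U : U' ≤ U := by
    rintro _ ⟨u, hu, rfl⟩
    exact U.nsmul_mem hu c
  haveI hU'fi : U'.FiniteIndex := by
    refine ⟨?_⟩
    rw [← AddSubgroup.relIndex_mul_index hU'U]
    refine mul_ne_zero ?_ hUfi.index_ne_zero
    rw [hU', hUidx c hidx]
    exact LocalPoints.card_quotient_span_natCast_ne_zero v hidx
  have hU'div : ∀ (s : ℕ), ∀ u ∈ U', ∃ u₁ ∈ U', p ^ s • u₁ = u := by
    rintro s _ ⟨u, hu, rfl⟩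
    obtain ⟨u₁, hu₁, rfl⟩ := hUdiv s u hu
    refine ⟨nsmulAddMonoidHom c u₁, ⟨u₁, hu₁, rfl⟩, ?_⟩
    change p ^ s • (c • u₁) = c • (p ^ s • u₁)
    rw [smul_comm]
  -- `n₀ = p^s · m`, `p ∤ m`
  set n₀ := U'.index with hn₀
  have hn₀0 : n₀ ≠ 0 := hU'fi.index_ne_zero
  set s := n₀.factorization p with hs
  set m := n₀ / p ^ s with hm
  have hn₀eq : p ^ s * m = n₀ := Nat.ordProj_mul_ordCompl_eq_self n₀ p
  have hpm : Nat.Coprime p m := Nat.coprime_ordCompl hp hn₀0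
  -- the class of `x`: `p^k x ∈ X₀(K_v)` with `k ≥ 1`
  obtain ⟨k₀, hk₀⟩ := hx
  set k := k₀ + 1 with hk
  have hkx : p ^ k • x ∈ E₀K := by
    rw [hk, pow_succ', mul_smul]; exact E₀K.nsmul_mem hk₀ p
  have hk1 : 1 < p ^ k := Nat.one_lt_pow (Nat.succ_ne_zero k₀) hp.one_lt
  -- `u ∈ U'` with `p^s u = n₀ x`
  have hn₀x : n₀ • x ∈ U' := U'.nsmul_index_mem x
  obtain ⟨u, hu, hpu⟩ := hU'div s (n₀ • x) hn₀x
  -- `t' = m x − u` is `p^s`-torsion, `≡ m x (mod X₀)`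
  set t' := m • x - u with ht'
  have ht'tors : p ^ s • t' = 0 := by
    rw [ht', smul_sub, hpu, smul_smul, hn₀eq, sub_self]
  -- invert `m` modulo `p^k`
  obtain ⟨m', -, hm'⟩ := Nat.exists_mul_mod_eq_one_of_coprime (hpm.symm.pow_right k) hk1
  set q := m * m' / p ^ k with hq
  have hmm' : m * m' = p ^ k * q + 1 := by
    have := Nat.div_add_mod (m * m') (p ^ k)
    rw [hm'] at this
    exact this.symm
  refine ⟨m' • t', ⟨s, by rw [smul_comm, ht'tors, smul_zero]⟩, ?_⟩
  have e : m' • t' - x = q • (p ^ k • x) - m' • u := by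
    rw [ht', smul_sub, smul_smul, mul_comm m' m, hmm', add_smul, one_smul, mul_comm (p ^ k) q,
      mul_smul]
    abel
  rw [e]
  exact E₀K.sub_mem (E₀K.nsmul_mem hkx q) (hU'E₀ (U'.nsmul_mem hu m'))

/-- **`K_v`-rational points are `Γ_{K_v}`-fixed in `X(K̄_v)`.** [cite: SilvermanAEC2009, VIII.§1] -/
theorem map_toAlgEquiv_map_ofId (X : WeierstrassCurve (v.adicCompletion K))
    (R : (X.baseChange (v.adicCompletion K)).toAffine.Point)
    (σ : absoluteGaloisGroup (v.adicCompletion K)) :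
    Affine.Point.map ((absoluteGaloisGroup.toAlgEquiv _ σ :
        AlgebraicClosure (v.adicCompletion K) ≃ₐ[v.adicCompletion K]
          AlgebraicClosure (v.adicCompletion K)) :
        AlgebraicClosure (v.adicCompletion K) →ₐ[v.adicCompletion K]
          AlgebraicClosure (v.adicCompletion K))
      (Affine.Point.map (W' := X)
        (Algebra.ofId (v.adicCompletion K) (AlgebraicClosure (v.adicCompletion K))) R) =
      Affine.Point.map (W' := X)
        (Algebra.ofId (v.adicCompletion K) (AlgebraicClosure (v.adicCompletion K))) R := by
  have hcomp : ((absoluteGaloisGroup.toAlgEquiv _ σ :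
        AlgebraicClosure (v.adicCompletion K) ≃ₐ[v.adicCompletion K]
          AlgebraicClosure (v.adicCompletion K)) :
        AlgebraicClosure (v.adicCompletion K) →ₐ[v.adicCompletion K]
          AlgebraicClosure (v.adicCompletion K)).comp
      (Algebra.ofId (v.adicCompletion K) (AlgebraicClosure (v.adicCompletion K))) =
      Algebra.ofId (v.adicCompletion K) (AlgebraicClosure (v.adicCompletion K)) :=
    AlgHom.ext fun z ↦ by rw [AlgHom.comp_apply]; exact AlgHom.commutes _ z
  rw [Affine.Point.map_map, hcomp]

end Local


end Summit.BirchSwinnertonDyer.Rank1Residual.X11b.AcSelmer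

end
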